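import Summits.ResolutionOfSingularities.ResolutionOfSingularities.Theorems.MarkedTransferCampaignW46HostSurfacesTransformProduct
import Summits.ResolutionOfSingularities.ResolutionOfSingularities.Theorems.MarkedTransferCampaignW46HostSurfacesMonomialEnd
import Summits.ResolutionOfSingularities.ResolutionOfSingularities.Theorems.MarkedTransferCampaignW46ThreefoldsGammaFreeGlobalSurfaces
import Summits.ResolutionOfSingularities.ResolutionOfSingularities.Theorems.MarkedTransferCampaignW46HostCurvesCloser
import Literature.AlgebraicGeometry.Resolution.MarkedIdealPointBlowup
import HarnessLib

/-!
# [OURS · L1 W4.6 rung (i) SURFACES, in the HOST ITEM'S OWN WORDS] `HypersurfaceOrderReductionDimLE p 2`, PROVED: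
# BGMW marked resolution of an effective Cartier marked ideal `(I, E, m)` on a regular surface over a perfect field

Cell res-hironaka, LADDER-RESOLUTION rung L (D-0089), slot W4.6 «restricted regimes as rungs», rung (i) SURFACES; seat res-L1-s46-pv-1
(gen 6). THE SURFACE RUNG OF res-L1-type-o1's HOST LADDER (`…W46HostLadder.lean`, p500045: the text of MarkedTransfer
`HypersurfaceOrderReductionDimLeThree` = stmt-ResolutionOfSingularities-16156 with `3 ↦ d`): `d = 1` was res-L1-s46-pv-10's
`hypersurfaceOrderReductionDimLE_one`, the Γ-free `d = 2` rung was res-D-pv-049 AS res-L1-s46-pv-11's `gammaFreeGlobalDimLE_two` (p514156);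
THIS FILE closes `d = 2` WITH THE SNC BOUNDARY — a partial result on the host item stmt-16156 itself (its `d ≤ 2` slice, in its own
words: `IsMarkedResolution`, BGMW Def. 3.1.3). Proposed `--kind proof --supports` stmt-16156 `--as helper`. Everything is OURS; nothing
here is a statement of H. Hironaka's manuscript [Hironaka2017]; no typed `Hironaka2017` candidate and no named FACT enters. AI-written;
AI review is weaker than expert review.

## The proof (embedded resolution of curves on surfaces, with boundary)

State: `X` a regular integral Noetherian surface, locally of finite type over a field `k`; `I ≠ 0` effective Cartier; `E` an snc
boundary; `m ≥ 1`. Put `J := I · ∏_{D ∈ E} D` (effective Cartier) and read res-L1-s46-pv-11's MEASURE `(Δ, Σ(i−1), Σ(k−2)⁺) ∈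
ℕ∞ ×ₗ ℕ ×ₗ ℕ` on the prime-divisor family of `V(J)` (bricks B10a `exists_primeDivisorFamily`, B10b `exists_family_measure_lt`).

* LOOP (`exists_isMarkedResolution_of_family`, well-founded induction on the measure): if some point `y` with `ord_y I ≥ m` is NOT an
  snc point of `Supp J`, blow `y` up — an admissible BGMW step (a closed point is a regular centre inside `supp(I, E, m)` having snc with
  every snc boundary, tree `HasSNC.hasSNCWith_vanishingIdeal_singleton`); the transformed marked ideal `(I′, E′, m)` has
  `I′ · ∏E′ = τᶜ(J, m + s − 1)` (`controlledTransform_mul_prod_eq`, `…HostSurfacesTransformProduct.lean`), so pv-11's brick B10b hands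
  over a prime-divisor family of `V(I′∏E′)` of SMALLER measure; recurse and prepend the step (`IsMarkedResolution.of_trans`).
* END-GAME (`exists_isMarkedResolution_of_sncAt_nhds`, `…HostSurfacesMonomialEnd.lean`): otherwise `Supp J` is snc on the open
  complement `U ⊇ Sing(I, m)` of its finitely many non-snc points (pv-11 `finite_setOf_not_sncAt_divisorial`), where the TREE's Kollár
  monomial resolution, boundary equivalence and open extension give the marked resolution.
* `d ≤ 1` is the host curve rung (res-L1-s46-pv-10 `hypersurfaceOrderReduction_of_dim_le_one`).

## What is proved

* `exists_isMarkedResolution_of_family` — the loop (for every value of the measure).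
* `hypersurfaceOrderReduction_of_dim_le_two` — universe-polymorphic, EVERY field `k`: `X` integral, regular, locally of finite type
  and quasi-compact over `k` with `topologicalKrullDim X ≤ 2`, `I ≠ 0` effective Cartier, `E` snc, `m ≥ 1`
  ⟹ `∃ X′ Φ M′, IsMarkedResolution ⟨I, E, m⟩ Φ M′` (perfectness, the characteristic and separatedness are not used).
* **`hypersurfaceOrderReductionDimLE_two (p) : HypersurfaceOrderReductionDimLE p 2`** — THE SURFACE RUNG OF THE HOST LADDER, closed by
  name; with `HypersurfaceOrderReductionDimLE.of_le` it re-proves `d ≤ 1`, and through the typer's `gammaFreeGlobalDimLE_of_host` it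
  re-proves the Γ-free surface rung.

## Sources

* R. Hartshorne, *Algebraic Geometry* (1977), Ch. V Thm. 3.9 (embedded resolution of curves in surfaces). [Hartshorne1977]
* J. Kollár, *Lectures on Resolution of Singularities* (2007), Thm. 1.47, (3.111) Step 3, Thm. 3.105. [Kollar2007]
* E. Bierstone, D. Grigoriev, P. Milman, J. Włodarczyk, arXiv:1206.3090, Def. 3.1.1–3.1.5. [BierstoneGrigorievMilmanWlodarczyk2011]
* H. Hironaka, ms. 2017-03-23, Def. 2.1 p.5, Th. 16.13 p.87 — scope only (the `d = 2` rung of the campaign's host ladder), under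
  adjudication, not cited as fact. [Hironaka2017]
-/

noncomputable section

set_option linter.dupNamespace false -- mandated namespace of this single-conjunct summit

open CategoryTheory AlgebraicGeometry TopologicalSpace IsLocalRing

namespace Summit.ResolutionOfSingularities.ResolutionOfSingularities.Theorems

namespace CampaignW46

open Literature.AlgebraicGeometry.Resolution
open Literature.AlgebraicGeometry.Hironaka2017
open Scheme.IdealSheafData

universe u

/-! ## The loop -/

/-- **[OURS · W4.6 rung (i), host words] THE SURFACE LOOP WITH BOUNDARY.** For a field `k`, `m ≥ 1` and a value `μ` of pv-11's
measure: every regular integral Noetherian `k`-scheme `X` locally of finite type with `topologicalKrullDim X = 2`, every effective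
Cartier `I ≠ 0`, every snc boundary `E` and every prime-divisor family of `V(I · ∏E)` of measure `μ` admit a BGMW marked resolution of
`(I, E, m)`. Well-founded induction on `μ ∈ ℕ∞ ×ₗ ℕ ×ₗ ℕ`; see the module docstring. [cite: Hartshorne1977, Ch. V Thm. 3.9]
[cite: BierstoneGrigorievMilmanWlodarczyk2011, Def. 3.1.3] -/
theorem exists_isMarkedResolution_of_family {k : Type u} [Field k] {m : ℕ} (hm : 1 ≤ m) (μ : ℕ∞ ×ₗ ℕ ×ₗ ℕ) :
    ∀ {ι : Type} [Finite ι] {X : Scheme.{u}} [IsIntegral X] [IsNoetherian X] (s : X ⟶ Spec (.of k))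
      [LocallyOfFiniteType s] (_ : Scheme.IsRegular X) (_ : topologicalKrullDim X = 2) {I : X.IdealSheafData} (_ : I ≠ ⊥)
      (_ : IsEffectiveCartier I) {E : List X.IdealSheafData} (_ : HasSNC E) (hJ : I * E.prod ≠ ⊥)
      (ζ : ι → X) (C : ι → Scheme.{u}) (i : ∀ l, C l ⟶ X) (_ : Function.Injective ζ)
      (_ : Set.range ζ = divisorialPoints (I * E.prod))
      (hfam : ∀ l, IsClosedImmersion (i l) ∧ ∃ (_ : IsIntegral (C l)) (_ : IsNoetherian (C l)),
        Scheme.IsQuasiExcellent (C l) ∧ topologicalKrullDim (C l) ≤ 1 ∧ i l (genericPoint (C l)) = ζ l),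
      toLex (@familyDelta ι C (fun l => (hfam l).2.1), toLex (familyTangency ζ, familyExcess ζ)) = μ →
        ∃ (X' : Scheme.{u}) (Φ : X' ⟶ X) (M' : MarkedIdeal X'), IsMarkedResolution (⟨I, E, m⟩ : MarkedIdeal X) Φ M' := by
  induction μ using WellFoundedLT.induction with
  | ind μ ih =>
  intro ι _ X _ _ s _ hX hd I hI hIc E hE hJ ζ C i hζinj hζrange hfam hμ
  haveI : IsLocallyNoetherian X := inferInstance
  have hdim : topologicalKrullDim X ≤ 2 := hd.le
  have hXe : Scheme.IsExcellent X := Scheme.isExcellent_of_locallyOfFiniteType Stacks07QW_field_holds s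
  have hXq : Scheme.IsQuasiExcellent X := hXe.isQuasiExcellent
  by_cases hall : ∀ y : X, (m : ℕ∞) ≤ idealOrder I y →
      SNCAt (((finite_divisorialPoints hJ).toFinset.toList).map primeDivisorIdeal) y
  · /- END-GAME: `Supp J` is snc on an open neighbourhood of `Sing(I, m)` -/
    obtain ⟨hFfin, hFcl⟩ := finite_setOf_not_sncAt_divisorial hX hXe hdim hJ
    have hFclosed : IsClosed {y : X | ¬ SNCAt (((finite_divisorialPoints hJ).toFinset.toList).map primeDivisorIdeal) y} := by
      rw [← Set.biUnion_of_singleton {y : X | ¬ SNCAt (((finite_divisorialPoints hJ).toFinset.toList).map primeDivisorIdeal) y}]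
      exact hFfin.isClosed_biUnion fun y hy => hFcl y hy
    let U : X.Opens := ⟨{y : X | ¬ SNCAt (((finite_divisorialPoints hJ).toFinset.toList).map primeDivisorIdeal) y}ᶜ,
      hFclosed.isOpen_compl⟩
    exact exists_isMarkedResolution_of_sncAt_nhds hX hXe hI hIc hE hm hJ U (fun y hy h => h (hall y hy))
      fun y hy => by by_contra h; exact hy h
  · /- STEP: blow up a non-snc point of `Sing(I, m)` -/
    push Not at hall
    obtain ⟨x, hxm, hxsnc⟩ := hall
    have hx : IsClosed ({x} : Set X) := (finite_setOf_not_sncAt_divisorial hX hXe hdim hJ).2 x hxsnc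
    have hR2 : ringKrullDim (X.presheaf.stalk x) = 2 := by rw [ringKrullDim_stalk_eq_of_isClosed s hx, hd]
    have hxne : ({x} : Set X) ≠ Set.univ := by
      intro h
      have hgen : genericPoint X ∈ ({x} : Set X) := h ▸ Set.mem_univ _
      rw [Set.mem_singleton_iff] at hgen
      have h1 : (1 : ℕ∞) ≤ idealOrder I x := le_trans (by exact_mod_cast hm) hxm
      rw [← hgen] at h1
      exact not_mem_support_genericPoint hI ((mem_support_iff_one_le_idealOrder I _).mpr h1)
    set P : X.IdealSheafData := vanishingIdeal ⟨{x}, hx⟩ with hP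
    obtain ⟨X', π, hπ⟩ := exists_isBlowup X P
    -- the BGMW step
    have hPreg : Scheme.IsRegular P.subscheme := isRegular_subscheme_vanishingIdeal_singleton hx
    have hPsupp : (P.support : Set X) ⊆ (⟨I, E, m⟩ : MarkedIdeal X).support := by
      intro y hy
      rw [hP, Scheme.IdealSheafData.coe_support_vanishingIdeal] at hy
      rw [show y = x from hy]
      exact hxm
    have hPsnc : HasSNCWith E P := HasSNC.hasSNCWith_vanishingIdeal_singleton hE hx
    have hstep : IsMultipleBlowup (⟨I, E, m⟩ : MarkedIdeal X) π ((⟨I, E, m⟩ : MarkedIdeal X).transform π P) :=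
      IsMultipleBlowup.single _ P π hπ hPreg hPsupp hPsnc
    -- the new surface
    haveI : IsIntegral X' := hπ.isIntegral (vanishingIdeal_singleton_ne_bot hx hxne)
    haveI : IsProper π := hπ.isProper
    haveI : IsLocallyNoetherian X' := LocallyOfFiniteType.isLocallyNoetherian π
    haveI : CompactSpace X' := QuasiCompact.compactSpace_of_compactSpace π
    haveI : IsNoetherian X' := {}
    have hX' : Scheme.IsRegular X' := hπ.isRegular_of_isRegular_subscheme hX hPreg
    have hd' : topologicalKrullDim X' = 2 := by
      rw [← hd]
      exact (hπ.isBirational' (vanishingIdeal_singleton_ne_bot hx hxne)).topologicalKrullDim_eq_of_isProper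
    -- the new marked ideal `(I′, E′, m)` and its ideal `J′ = I′ ∏E′ = τᶜ(J, m + s − 1)`
    obtain ⟨hI', hIc'⟩ := controlledTransform_ne_bot_and_isEffectiveCartier_point hX hx hxne hπ hI hIc hxm
    have hE' : HasSNC ((⟨I, E, m⟩ : MarkedIdeal X).transform π P).boundary :=
      MarkedIdeal.hasSNC_transform_boundary _ hPsnc hπ
    have hIC : I ≤ P ^ m :=
      le_vanishingIdeal_pow_of_forall_le_idealOrder hX hPreg fun y hy => by rw [show y = x from hy]; exact hxm
    have hη : IsGenericPoint x (P.support : Set X) := by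
      rw [hP, Scheme.IdealSheafData.coe_support_vanishingIdeal]
      exact hx.closure_eq
    have hint : interior (P.support : Set X) = ∅ := by
      rw [hP, Scheme.IdealSheafData.coe_support_vanishingIdeal]; exact interior_singleton_eq_empty hx hxne
    have hEc : ∀ D ∈ E, IsEffectiveCartier D := fun D hD => HasSNC.isEffectiveCartier_of_mem hE hD
    have hEne : ∀ D ∈ E, D ≠ ⊥ := fun D hD => HasSNC.ne_bot_of_mem hE hD
    have hJ'eq := controlledTransform_mul_prod_eq hX hPreg hη hint hπ hm hIC E hEc hEne
    set μ' := m + (E.map fun D => (idealOrder D x).toNat).sum - 1 with hμ'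
    obtain ⟨ι', hfinι', ζ', C', i', hfam', hinj', hrange', hlt⟩ :=
      exists_family_measure_lt hX hXq hdim hx hxne hR2 hπ hJ μ' ζ C i hζinj hζrange hfam hxsnc
    rw [hJ'eq] at hrange'
    -- an effective Cartier ideal on a non-empty scheme is `≠ ⊥`
    have hne : ∀ {W : Scheme.{u}} [Nonempty W] {K : W.IdealSheafData}, IsEffectiveCartier K → K ≠ ⊥ := by
      intro W _ K hK h0
      obtain ⟨U, hxU, g, hg, hU⟩ := hK (Classical.arbitrary W)
      rw [h0, Scheme.IdealSheafData.ideal_bot, Pi.bot_apply, eq_comm, Ideal.span_singleton_eq_bot] at hU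
      subst hU
      haveI : Nonempty (U : W.Opens) := ⟨⟨_, hxU⟩⟩
      exact zero_notMem_nonZeroDivisors hg
    have hJ' : controlledTransform π P I m * (E.map (strictTransformIdeal π P) ++ [P.comap π]).prod ≠ ⊥ :=
      hne (hIc'.mul (HasSNC.isEffectiveCartier_prod hE'))
    haveI := hfinι'
    obtain ⟨X'', Φ, M'', hres⟩ := ih _ (hμ ▸ hlt) (π ≫ s) hX' hd' hI' hIc' hE' hJ' ζ' C' i' hinj' hrange' hfam' rfl
    exact ⟨X'', Φ ≫ π, M'', IsMarkedResolution.of_trans hstep hres⟩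


/-! ## The surface rung -/

/-- **[OURS · W4.6 rung (i), host words] MARKED ORDER REDUCTION OF EFFECTIVE CARTIER MARKED IDEALS ON REGULAR SURFACES** (universe
polymorphic; every field). For a field `k`, a quasi-compact integral regular `k`-scheme `X` locally of finite type with
`topologicalKrullDim X ≤ 2`, an effective Cartier ideal `I ≠ 0`, an snc boundary `E` and `m ≥ 1`, the marked ideal `(X, I, E, m)`
has a BGMW marked resolution: `∃ X′ (Φ : X′ ⟶ X) M′, IsMarkedResolution ⟨I, E, m⟩ Φ M′`. Dimension `≤ 1`: res-L1-s46-pv-10's host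
curve rung; dimension `2`: the loop `exists_isMarkedResolution_of_family` entered through pv-11's brick B10a (a prime-divisor family of
`V(I · ∏E)`). [cite: Hartshorne1977, Ch. V Thm. 3.9] [cite: BierstoneGrigorievMilmanWlodarczyk2011, Def. 3.1.3] -/
theorem hypersurfaceOrderReduction_of_dim_le_two {k : Type u} [Field k] (X : Scheme.{u}) (s : X ⟶ Spec (.of k))
    [LocallyOfFiniteType s] [QuasiCompact s] [IsIntegral X] (hreg : Scheme.IsRegular X) (hdim : topologicalKrullDim X ≤ 2)
    (I : X.IdealSheafData) (hI : I ≠ ⊥) (hIc : IsEffectiveCartier I) (E : List X.IdealSheafData) (hE : HasSNC E)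
    (m : ℕ) (hm : 1 ≤ m) :
    ∃ (X' : Scheme.{u}) (Φ : X' ⟶ X) (M' : MarkedIdeal X'), IsMarkedResolution (⟨I, E, m⟩ : MarkedIdeal X) Φ M' := by
  haveI : IsLocallyNoetherian X := LocallyOfFiniteType.isLocallyNoetherian s
  haveI : CompactSpace X := QuasiCompact.compactSpace_of_compactSpace s
  haveI : IsNoetherian X := {}
  by_cases hd1 : topologicalKrullDim X ≤ 1
  · exact hypersurfaceOrderReduction_of_dim_le_one X s hreg hd1 I hI E hE m hm
  · have hd : topologicalKrullDim X = 2 := withBotENat_eq_two hdim hd1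
    have hXe : Scheme.IsExcellent X := Scheme.isExcellent_of_locallyOfFiniteType Stacks07QW_field_holds s
    -- an effective Cartier ideal on a non-empty scheme is `≠ ⊥`
    have hne : ∀ {W : Scheme.{u}} [Nonempty W] {K : W.IdealSheafData}, IsEffectiveCartier K → K ≠ ⊥ := by
      intro W _ K hK h0
      obtain ⟨U, hxU, g, hg, hU⟩ := hK (Classical.arbitrary W)
      rw [h0, Scheme.IdealSheafData.ideal_bot, Pi.bot_apply, eq_comm, Ideal.span_singleton_eq_bot] at hU
      subst hU
      haveI : Nonempty (U : W.Opens) := ⟨⟨_, hxU⟩⟩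
      exact zero_notMem_nonZeroDivisors hg
    have hJ : I * E.prod ≠ ⊥ := hne (hIc.mul (HasSNC.isEffectiveCartier_prod hE))
    obtain ⟨n, ζ, C, i, hζinj, hζrange, hfam⟩ := exists_primeDivisorFamily hXe.isQuasiExcellent hdim hJ
    exact exists_isMarkedResolution_of_family hm _ s hreg hd hI hIc hE hJ ζ C i hζinj hζrange hfam rfl

/-- **[OURS · W4.6 RUNG (i) SURFACES, IN THE HOST ITEM'S OWN WORDS] `HypersurfaceOrderReductionDimLE p 2`, PROVED** — the surface
rung of res-L1-type-o1's host ladder (`…W46HostLadder.lean`: MarkedTransfer `HypersurfaceOrderReductionDimLeThree` =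
stmt-ResolutionOfSingularities-16156 with `3 ↦ d`): for every prime `p`, every perfect field `k` of characteristic `p`, every
separated quasi-compact `k`-scheme `X` locally of finite type, integral and regular, of dimension `≤ 2`, every effective Cartier
`I ≠ ⊥`, every snc boundary `E` and every `m ≥ 1`, the marked ideal `(I, E, m)` has a BGMW marked resolution (by
`hypersurfaceOrderReduction_of_dim_le_two`; the characteristic, perfectness and separatedness binders are carried, not used). A partial
result on the host item stmt-16156 itself (its `d ≤ 2` slice); nothing about `d = 3`. Replaces the role of «(i) SURFACES: the typed
Th. 16.6 procedure terminates — and reduces order with snc boundary — where the host item applies» (RESCUE-SEED W4.6 (i)); NOT a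
statement of the manuscript. [cite: BierstoneGrigorievMilmanWlodarczyk2011, Def. 3.1.3] [cite: Hartshorne1977, Ch. V Thm. 3.9] -/
theorem hypersurfaceOrderReductionDimLE_two (p : ℕ) : HypersurfaceOrderReductionDimLE p 2 := by
  intro _ k _ _ _ X s _ hloft hqc hint hreg hdim I hI hIc E hE m hm
  haveI := hloft
  haveI := hqc
  haveI := hint
  exact hypersurfaceOrderReduction_of_dim_le_two X s hreg (by exact_mod_cast hdim) I hI hIc E hE m hm

/-- Consistency: the surface rung re-proves the host curve rung `d ≤ 1` (antitonicity) and, through the typer's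
`gammaFreeGlobalDimLE_of_host`, the Γ-free surface rung `GammaFreeGlobalOrderReductionDimLE.{0} p 2` (res-L1-s46-pv-11's p514156, there
universe-polymorphic and by a different end-game). [folklore] -/
theorem gammaFreeGlobalDimLE_two_of_host (p : ℕ) : GammaFreeGlobalOrderReductionDimLE.{0} p 2 :=
  gammaFreeGlobalDimLE_of_host (hypersurfaceOrderReductionDimLE_two p)

end CampaignW46

end Summit.ResolutionOfSingularities.ResolutionOfSingularities.Theorems

end
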